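import Mathlib
import Literature.Computability.AlgebraicComplexity.ValiantClasses
import Literature.Computability.AlgebraicComplexity.ArithCircuit
import Literature.Computability.AlgebraicComplexity.SOSDecomposition
import Literature.Computability.AlgebraicComplexity.SOSDecompositionProofs
import Summits.ValiantsHypothesis.ValiantsHypothesis.Theses.FeketeSOS
import Summits.ValiantsHypothesis.ValiantsHypothesis.Theorems.SOSMagnification.Negative.FeketeHardDeltaRange

/-!
# Line `gauss-phase-definability` — skeleton for crux `FeketeSOS.SOSMagnification`
# (stmt-ValiantsHypothesis-3995; route route-ValiantsHypothesis-FeketeSOS)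

Crux (by name): `Summit.ValiantsHypothesis.ValiantsHypothesis.Theses.FeketeSOS.SOSMagnification`,
literally `FeketeSOSHard → ValiantsHypothesis` (`Disproof.sosMagnification_iff`): Dutta–Saxena–Thierauf
magnification of an SOS support-sum lower bound for the Fekete polynomials `F_p = ∑_{m<p} (m|p) X^m`
into `VP_ℂ ≠ VNP_ℂ`.

## The line (idea card `Ideas/gauss-phase-definability.md`, triage r1: 3 × pass)

DST's bridge has two halves.  (V) the one-hot base-`k` Legendre digit lift
`Fek_{k,p,n} = ∑_{m<p} (m|p)·∏_{j<n} x_{j, digit_j(m)}` is p-DEFINABLE over `ℂ`; (T) an SOS-hard `F_p`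
(the route hypothesis X = `FeketeSOSHard`) forces `Fek ∉ VP_ℂ` (Lemma 3.1 PROVED in tree + inverse
Kronecker substitution + a count).  The LEVER of this line is (V) done on the Fourier side, with no
Valiant criterion and no Boolean arithmetic for the Legendre symbol: for an odd prime `p`, a primitive
`p`-th root of unity `ω` and `τ = ∑_{y<p} ω^{y²} ≠ 0`,

  `τ·(m|p) = ∑_{y<p} ω^{m y²} − ∑_{y<p} ω^{m y}`                         (S1 `GaussStep`),

and for Boolean `y = ∑_t y_t 2^t` the quadratic phase is an explicit product of `O(T²)` bilinear factors

  `ζ^{y²} = ∏_t (1 + y_t(ζ^{4^t} − 1)) · ∏_{t<u} (1 + y_t y_u (ζ^{2^{t+u+1}} − 1))`   (S2 `PhaseFactorisation`);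

with the truncation `m < p` done by digit-prefix splitting and the range `y < p` by a comparator, this
writes `Fek_{k,p,n} = boolSum_{y ∈ {0,1}^T} g` for an EXPLICIT `g` of complexity `O(n²kT²)` and degree
`O(nT²)` (S3 `BoolSumWitness`, load-bearing), hence `IsVNPFamily` by Bürgisser's Def. 2.5 as rendered in
the tree (S4 `FekDigitDefinable`).  The (T) half is S5 `KroneckerTransport` (unconditional algebra:
circuit ⇒ cheap univariate weighted-SOS representation of `F_p`) and S6 `CountingEndgame` (pure
asymptotics).  `SOSMagnification_of` below composes S1–S6 to the crux BY NAME, sorry-free.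

Frame: FIXED radix `k ≥ k₀(δ)` (DST; the frame of the kernel-checked composition of
`Cruxes/SOSMagnification/SketchIdeator3.lean` and of the sibling line `family-cut-transfer-lemma`, so S5/S6
are shareable); the card's growing radix `k = n+1` is a variant (see the line card).

## Disproof.lean used
* `not_sosMagnification_iff` (immunity): every stub is PROOF-side; no stub restates X, the crux or the summit.
* landed `Theorems/SOSMagnification/Negative/FeketeHardDeltaRange` (p73035):
  `exists_delta_le_half_of_feketeSOSHard` is USED in `SOSMagnification_of`, so S6 may assume `δ ≤ 1/2`.
* finding 5/5b/5c (restricted hypothesis suffices; onset `n₀ ≈ 1.3k–3.3k` with the tree's `c = 8`): S5 keeps the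
  Lemma-3.1 constant symbolic (`∃ c`, as the named fact exports it) and S6 is stated for every `c`.
* Disproof.lean has no `_false_without_` theorem for this crux (none bites a proof line).

Triage answers: every family-level hypothesis is guarded `1 ≤ n →` (the r1 vacuity slip of `FirstLemmaA`);
`p = 2` (where `τ = 0`) is excluded by `pSel n ≠ 2`; `p < kⁿ` STRICT is guaranteed in the composition by an
EVEN radix, so S3 never meets the corner `p = kⁿ`.
-/

noncomputable section

open MvPolynomial Finset
open scoped BigOperators
open Literature.Computability.AlgebraicComplexity

namespace Summit.ValiantsHypothesis.ValiantsHypothesis.Cruxes.SOSMagnification.GaussPhaseDefinability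

set_option linter.dupNamespace false

/-! ## Objects (`digit`, `fekDigit`, `feketePoly` verbatim-compatible with
`Cruxes/SOSMagnification/SketchIdeator3.lean`; the Kronecker substitution used inside S5 is
`κ : x_{j,ℓ} ↦ X^{ℓ·k^j}`, i.e. `MvPolynomial.aeval (fun v : Fin n × Fin k => Polynomial.X ^ ((v.2 : ℕ) * k ^ (v.1 : ℕ)))`) -/

/-- the `j`-th base-`k` digit of `m`, as an element of `Fin k` -/
def digit (k : ℕ) [NeZero k] (m j : ℕ) : Fin k :=
  ⟨(m / k ^ j) % k, Nat.mod_lt _ (Nat.pos_of_neZero k)⟩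

/-- DST's one-hot digit lift of `F_p` (inverse multilinear Kronecker image):
`Fek_{k,p,n} = ∑_{m<p} (m|p) · ∏_{j<n} x_{j, digit_j(m)}` in the `n·k` variables `x_{j,ℓ}`. -/
def fekDigit (k : ℕ) [NeZero k] (p : ℕ) [Fact p.Prime] (n : ℕ) : MvPolynomial (Fin n × Fin k) ℂ :=
  ∑ m ∈ range p, C ((legendreSym p m : ℤ) : ℂ) * ∏ j : Fin n, X (j, digit k m j)

/-- the Fekete polynomial exactly as inlined in the route items -/
def feketePoly (p : ℕ) [Fact p.Prime] : Polynomial ℂ :=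
  ∑ m ∈ range p, Polynomial.C ((legendreSym p m : ℤ) : ℂ) * Polynomial.X ^ m

/-- value of a bit vector, `∑_t e_t 2^t` -/
def bitsVal {T : ℕ} (e : Fin T → Bool) : ℕ :=
  ∑ t : Fin T, if e t then 2 ^ (t : ℕ) else 0

/-- The quadratic PHASE GADGET `Φ_ζ` on `T` bit-variables:
`∏_t (1 + X_t·(ζ^{4^t} − 1)) · ∏_{t<u} (1 + X_t X_u·(ζ^{2^{t+u+1}} − 1))` — `T + T(T−1)/2` affine/bilinear
factors whose Boolean evaluation at `e` is `ζ^{(bitsVal e)²}` (S2). -/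
def phaseGadget (ζ : ℂ) (T : ℕ) : MvPolynomial (Fin T) ℂ :=
  (∏ t : Fin T, ((1 : MvPolynomial (Fin T) ℂ) + X t * C (ζ ^ (4 ^ (t : ℕ)) - 1))) *
    ∏ t : Fin T, ∏ u : Fin T,
      (if (t : ℕ) < (u : ℕ) then
        (1 : MvPolynomial (Fin T) ℂ) + X t * X u * C (ζ ^ (2 ^ ((t : ℕ) + (u : ℕ) + 1)) - 1)
      else 1)

/-! ## Stub statements -/

/-- **S1 (Gauss step).** For an odd prime `p` and a primitive `p`-th root of unity `ω`, the
quadratic Gauss sum `τ = ∑_{y<p} ω^{y²}` is nonzero and `∑_{y<p} ω^{m y²} − ∑_{y<p} ω^{m y} = τ·(m|p)`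
for every `m : ℕ` (for `p ∣ m` both sides vanish).  Mathlib: `quadraticChar_card_sqrts`,
`gaussSum_sq` / `gaussSum_ne_zero`-type facts for `ZMod.stdAddChar`, `AddChar.sum_eq_zero_of_ne_one`,
`legendreSym p m = quadraticChar (ZMod p) m`; transport `range p ↔ ZMod p`.  [size M] -/
def GaussStep : Prop :=
  ∀ (p : ℕ) [Fact p.Prime], p ≠ 2 → ∀ (ω : ℂ), IsPrimitiveRoot ω p →
    (∑ y ∈ range p, ω ^ (y ^ 2)) ≠ 0 ∧
    ∀ m : ℕ, (∑ y ∈ range p, ω ^ (m * y ^ 2)) - (∑ y ∈ range p, ω ^ (m * y)) =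
      (∑ y ∈ range p, ω ^ (y ^ 2)) * ((legendreSym p m : ℤ) : ℂ)

/-- **S2 (Boolean phase factorisation).** At a Boolean point `e`, the phase gadget evaluates to
`ζ^{v²}`, `v = bitsVal e`: expand `v² = ∑_t e_t 4^t + ∑_{t<u} e_t e_u 2^{t+u+1}` (`e_t² = e_t`) and
`ζ^{e·c} = 1 + e(ζ^c − 1)` for `e ∈ {0,1}`.  Holds for every `ζ`.  [size S–M] -/
def PhaseFactorisation : Prop :=
  ∀ (ζ : ℂ) (T : ℕ) (e : Fin T → Bool),
    MvPolynomial.eval (fun t => if e t then (1 : ℂ) else 0) (phaseGadget ζ T) = ζ ^ (bitsVal e ^ 2)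

/-- **S3 (the explicit Boolean-sum witness; LOAD-BEARING).** There are absolute constants `A, B`
such that for every radix `k ≥ 2`, odd prime `p < kⁿ`, and `T` with `p < 2^T`, some
`g ∈ ℂ[x_{j,ℓ}, y_t]` has `boolSum_y g = Fek_{k,p,n}`, complexity `≤ A(nkT+1)^B` and degree `≤ A(nkT+1)^B`.
Intended witness (card, toy-verified by all three triagers):
`g = τ⁻¹ · LT_p(y) · (A_n(x,y) − B_n(x,y))` with `ω = exp(2πi/p)`,
`LT_p(y) = ∑_{t : p_t = 1} (1 − y_t) ∏_{u>t} [y_u = p_u]` (comparator `y < p`),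
`A_n = ∑_{j₀<n} (∏_{j>j₀} Φ_{ω^{p_j k^j}}(y) x_{j,p_j}) (∑_{e<p_{j₀}} Φ_{ω^{e k^{j₀}}}(y) x_{j₀,e}) ∏_{j<j₀} (∑_{e<k} Φ_{ω^{e k^j}}(y) x_{j,e})`
(digit-prefix truncation of `m < p`, `p_j` = base-`k` digits of `p`; quadratic gadget `Φ` = `phaseGadget`)
and `B_n` the same with the linear gadget `Ψ_c(y) = ∏_t (1 + y_t(ω^{c 2^t} − 1))`; correctness on
VALUES at Boolean `y` by S1 + S2, cost on the EXPRESSION by `complexity_finset_sum_le/prod_le`,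
`complexity_X/C_holds` (constants free).  [size L; HARDEST] -/
def BoolSumWitness : Prop :=
  ∃ A B : ℕ, ∀ (k : ℕ) [NeZero k] (p : ℕ) [Fact p.Prime] (n T : ℕ),
    2 ≤ k → p ≠ 2 → p < k ^ n → p < 2 ^ T →
    ∃ g : MvPolynomial ((Fin n × Fin k) ⊕ Fin T) ℂ,
      boolSum g = fekDigit k p n ∧
      complexity g ≤ A * (n * k * T + 1) ^ B ∧
      g.totalDegree ≤ A * (n * k * T + 1) ^ B

/-- **S4 (definability of the family; Bürgisser Def. 2.5 bookkeeping).** For a fixed radix `k ≥ 2`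
and any prime selector `pSel` with `pSel n` odd and `< kⁿ` for `n ≥ 1`, the family
`(Fek_{k, pSel n, n})_n` is in `VNP_ℂ`: `IsPFamily` (card `= nk`, `totalDegree ≤ n`), Boolean length
`u n := Nat.log 2 (k^n) + 1`, witnesses from S3 for `n ≥ 1` and the trivial witness at `n = 0`
(a constant member), p-boundedness via `IsPBounded.add/mul/comp_holds`.  [size M] -/
def FekDigitDefinable : Prop :=
  ∀ (k : ℕ) [NeZero k], 2 ≤ k → ∀ (pSel : ℕ → ℕ) [∀ n, Fact (pSel n).Prime],
    (∀ n, 1 ≤ n → pSel n ≠ 2) → (∀ n, 1 ≤ n → pSel n < k ^ n) →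
    IsVNPFamily (k := ℂ) (σ := fun n => Fin n × Fin k) (fun n => fekDigit k (pSel n) n)

/-- **S5 (Kronecker transport of DST Lemma 3.1; unconditional, prime enters only via `p ≤ kⁿ`).**
There is an absolute `c` (the constant of the tree's named fact
`DuttaSaxenaThierauf2024_sosDecomposition`, PROVED as `_holds`) such that a circuit of size `s` for
`Fek_{k,p,n}` yields `F_p = ∑_{i<s'} aᵢ gᵢ²` over `ℂ` with `s' ≤ (sn+2)^{c(⌊log₂n⌋+1)}`,
`deg gᵢ ≤ ⌈n/2⌉(k−1)k^{n−1}` and `|supp gᵢ| ≤ C(kn+⌈n/2⌉, ⌈n/2⌉)`: rename `Fin n × Fin k ≃ Fin (n·k)`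
(`complexity_renameEquiv_holds`, `totalDegree_renameEquiv`), apply Lemma 3.1 (`totalDegree Fek ≤ n`,
monotonicity in the degree), push through the algebra hom `κ = aeval (x_{j,ℓ} ↦ X^{ℓ k^j})` (faithful on the lift since
`m < p ≤ kⁿ` has `n` digits), count monomials of degree `≤ ⌈n/2⌉` in `nk` variables
(`card_support_aeval_le_of_isTerm` / `multichoose_eq_card_degreeMonomials` in tree).  [size L] -/
def KroneckerTransport : Prop :=
  ∃ c : ℕ, ∀ (k : ℕ) [NeZero k] (p : ℕ) [Fact p.Prime] (n s : ℕ),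
    2 ≤ k → 1 ≤ n → p ≤ k ^ n → complexity (fekDigit k p n) ≤ s →
    ∃ (s' : ℕ) (a : Fin s' → ℂ) (g : Fin s' → Polynomial ℂ),
      s' ≤ (s * n + 2) ^ (c * (Nat.log 2 n + 1)) ∧
      (∀ i, (g i).natDegree ≤ ((n + 1) / 2) * (k - 1) * k ^ (n - 1)) ∧
      (∀ i, (g i).support.card ≤ (k * n + (n + 1) / 2).choose ((n + 1) / 2)) ∧
      (∑ i, Polynomial.C (a i) * g i ^ 2) = feketePoly p

/-- **S6 (counting endgame; pure asymptotics, DST24 Claim 3.4 / Disproof finding 5b).** For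
`δ ∈ (0, 1/2]` and any Lemma-3.1 constant `c` there is a radix threshold `k₀` (any `k₀ > e^{1.05/δ}`
works: `δ·ln k > ½(1 + ln(2 + 1/k))`) such that for every `k ≥ k₀` and every complexity exponent `a`,
for all large `n` and every `p ∈ (kⁿ/2, kⁿ]`:
(i) `((nᵃ+a)n+2)^{c(⌊log₂n⌋+1)} ≤ p^δ` (quasi-polynomial vs `≈ k^{nδ}`),
(ii) `⌈n/2⌉(k−1)k^{n−1} ≤ p²`,
(iii) `((nᵃ+a)n+2)^{c(⌊log₂n⌋+1)} · C(kn+⌈n/2⌉,⌈n/2⌉) < p^{1/2+δ}` (`C(kn+r,r) ≤ (e(2k+1))^r`).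
Real analysis only (`Real.rpow`, `Real.log`, `Nat.choose_le_pow_div`/factorial bounds,
`isLittleO_log_rpow`-type lemmas).  [size M–L] -/
def CountingEndgame : Prop :=
  ∀ (δ : ℝ), 0 < δ → δ ≤ 1 / 2 → ∀ c : ℕ, ∃ k₀ : ℕ, ∀ k : ℕ, k₀ ≤ k → ∀ a : ℕ, ∃ n₀ : ℕ,
    ∀ n : ℕ, n₀ ≤ n → ∀ p : ℕ, k ^ n < 2 * p → p ≤ k ^ n →
      ((((n ^ a + a) * n + 2) ^ (c * (Nat.log 2 n + 1)) : ℕ) : ℝ) ≤ (p : ℝ) ^ δ ∧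
      ((n + 1) / 2) * (k - 1) * k ^ (n - 1) ≤ p ^ 2 ∧
      ((((n ^ a + a) * n + 2) ^ (c * (Nat.log 2 n + 1)) *
          (k * n + (n + 1) / 2).choose ((n + 1) / 2) : ℕ) : ℝ) < (p : ℝ) ^ (1 / 2 + δ)

/-! ## Non-vacuity guards (triage r1 flagged an `n = 0` slip in the ideators' first lemmas) -/

/-- the hypotheses of S4 are satisfiable (radix `4`, the constant selector `3`) -/
example : ∃ (k : ℕ) (pSel : ℕ → ℕ), 2 ≤ k ∧ (∀ n, (pSel n).Prime) ∧
    (∀ n, 1 ≤ n → pSel n ≠ 2) ∧ (∀ n, 1 ≤ n → pSel n < k ^ n) :=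
  ⟨4, fun _ => 3, by norm_num, fun _ => Nat.prime_three, fun _ _ => by norm_num, fun n hn =>
    calc 3 < 4 := by norm_num
      _ = 4 ^ 1 := by norm_num
      _ ≤ 4 ^ n := Nat.pow_le_pow_right (by norm_num) hn⟩

/-- the hypotheses of S3 are satisfiable: `(k, p, n, T) = (2, 3, 2, 2)` -/
example : ∃ k p n T : ℕ, 2 ≤ k ∧ p.Prime ∧ p ≠ 2 ∧ p < k ^ n ∧ p < 2 ^ T :=
  ⟨2, 3, 2, 2, le_rfl, Nat.prime_three, by norm_num, by norm_num, by norm_num⟩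

/-- the hypotheses of S5 are satisfiable: `(k, p, n) = (2, 3, 2)` -/
example : ∃ k p n : ℕ, 2 ≤ k ∧ p.Prime ∧ 1 ≤ n ∧ p ≤ k ^ n :=
  ⟨2, 3, 2, le_rfl, Nat.prime_three, by norm_num, by norm_num⟩

/-! ## Registered stubs (the ONLY sorries of this file) -/

/-- stub S1 — see `GaussStep`. -/
theorem stub_gaussStep : GaussStep := by
  sorry

/-- stub S2 — see `PhaseFactorisation`. -/
theorem stub_phaseFactorisation : PhaseFactorisation := by
  sorry

/-- stub S3 (hardest, load-bearing) — the explicit witness, from the two identities. -/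
theorem stub_boolSumWitness : GaussStep → PhaseFactorisation → BoolSumWitness := by
  sorry

/-- stub S4 — level-wise witnesses ⇒ `IsVNPFamily` (Bürgisser Def. 2.5 as rendered by `IsVNPFamily`). -/
theorem stub_definable : BoolSumWitness → FekDigitDefinable := by
  sorry

/-- stub S5 — see `KroneckerTransport`. -/
theorem stub_kroneckerTransport : KroneckerTransport := by
  sorry

/-- stub S6 — see `CountingEndgame`. -/
theorem stub_countingEndgame : CountingEndgame := by
  sorry

/-! ## Composition (sorry-free): S1–S6 ⇒ the crux, by name -/

/-- **The line concludes the crux.** From S1–S4 the digit family is in `VNP_ℂ` for every admissible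
radix/selector; if `VP_ℂ = VNP_ℂ` it is in `VP_ℂ`, so its `n`-th member has complexity `≤ nᵃ + a`; S5 turns
that circuit into a weighted-SOS representation of `F_{pₙ}` with few, low-degree, sparse squares, and S6
shows this representation violates X at `p = pₙ` for large `n` — contradiction.  Choices made here:
`δ ≤ 1/2` by the landed negative lemma `exists_delta_le_half_of_feketeSOSHard`; an EVEN radix
`k = 2·max k₀ 2` (so `pₙ < kⁿ` strictly and `pₙ ≠ 2`); Bertrand primes `pₙ ∈ (kⁿ/2, kⁿ]` for `n ≥ 1`. -/
theorem SOSMagnification_of :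
    Summit.ValiantsHypothesis.ValiantsHypothesis.Theses.FeketeSOS.SOSMagnification := by
  -- (V) half of the line: stubs S1–S4
  have hDef : FekDigitDefinable :=
    stub_definable (stub_boolSumWitness stub_gaussStep stub_phaseFactorisation)
  -- (T) half: stubs S5–S6
  obtain ⟨cT, hT⟩ := stub_kroneckerTransport
  intro hX
  show VP ℂ ≠ VNP ℂ
  intro hEq
  -- δ ∈ (0, 1/2] from X (landed negative lemma, p73035)
  obtain ⟨δ, hδ, hδ2, p₀, H⟩ :=
    Summit.ValiantsHypothesis.ValiantsHypothesis.Theorems.SOSMagnification.Negative.exists_delta_le_half_of_feketeSOSHard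
      hX
  obtain ⟨k₀, hk₀⟩ := stub_countingEndgame δ hδ hδ2 cT
  -- an even radix `k ≥ max k₀ 4`
  obtain ⟨k, hk0, hk4, hkeven⟩ : ∃ k : ℕ, k₀ ≤ k ∧ 4 ≤ k ∧ 2 ∣ k :=
    ⟨2 * max k₀ 2, by omega, by omega, dvd_mul_right 2 _⟩
  haveI : NeZero k := ⟨by omega⟩
  have hkpow : ∀ n : ℕ, 1 ≤ n → 4 ≤ k ^ n := fun n hn =>
    calc 4 ≤ k := hk4
      _ = k ^ 1 := (pow_one k).symm
      _ ≤ k ^ n := Nat.pow_le_pow_right (by omega) hn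
  -- a prime selector in the Bertrand window `(kⁿ/2, kⁿ]` for `n ≥ 1` (`p₀ := 3` at `n = 0`)
  have hsel : ∀ n : ℕ, ∃ p : ℕ, p.Prime ∧ (1 ≤ n → k ^ n < 2 * p) ∧ (1 ≤ n → p ≤ k ^ n) := by
    intro n
    rcases Nat.eq_zero_or_pos n with rfl | hn
    · exact ⟨3, Nat.prime_three, fun h => absurd h (by norm_num), fun h => absurd h (by norm_num)⟩
    · have hkn : 4 ≤ k ^ n := hkpow n hn
      obtain ⟨p, hp, hlt, hle⟩ := Nat.exists_prime_lt_and_le_two_mul (k ^ n / 2) (by omega)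
      exact ⟨p, hp, fun _ => by omega, fun _ => by omega⟩
  choose pSel hpP hpbig hple using hsel
  haveI : ∀ n, Fact (pSel n).Prime := fun n => ⟨hpP n⟩
  have hodd : ∀ n, 1 ≤ n → pSel n ≠ 2 := by
    intro n hn
    have h1 := hkpow n hn
    have h2 := hpbig n hn
    omega
  have hlt : ∀ n, 1 ≤ n → pSel n < k ^ n := by
    intro n hn
    have hle := hple n hn
    have hbig := hpbig n hn
    have h1 := hkpow n hn
    rcases hle.lt_or_eq with h | h
    · exact h
    · exfalso
      have h2 : 2 ∣ pSel n := by
        rw [h]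
        exact dvd_pow hkeven (by omega)
      rcases (hpP n).eq_one_or_self_of_dvd 2 h2 with h3 | h3
      · omega
      · omega
  -- the family is in VNP …
  have hVNP : IsVNPFamily (k := ℂ) (σ := fun n => Fin n × Fin k) (fun n => fekDigit k (pSel n) n) :=
    hDef k (by omega) pSel hodd hlt
  -- … hence, under `VP = VNP`, in VP
  have hVP : IsVPFamily (k := ℂ) (σ := fun n => Fin n × Fin k) (fun n => fekDigit k (pSel n) n) := by
    have hmem : PolyFamily.ofFintype (fun n => fekDigit k (pSel n) n) ∈ VNP ℂ :=
      (mem_VNP_ofFintype_iff_holds (k := ℂ) (σ := fun n => Fin n × Fin k)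
        (fun n => fekDigit k (pSel n) n)).2 hVNP
    rw [← hEq] at hmem
    exact (mem_VP_ofFintype_iff_holds (k := ℂ) (σ := fun n => Fin n × Fin k)
      (fun n => fekDigit k (pSel n) n)).1 hmem
  obtain ⟨a, ha⟩ := hVP.2
  obtain ⟨n₀, hn₀⟩ := hk₀ k hk0 a
  -- the level `n` at which X is contradicted
  obtain ⟨n, hn0, hn1, hnp⟩ : ∃ n : ℕ, n₀ ≤ n ∧ 1 ≤ n ∧ 2 * p₀ ≤ n :=
    ⟨max n₀ (max 1 (2 * p₀)), le_max_left _ _, le_trans (le_max_left _ _) (le_max_right _ _),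
      le_trans (le_max_right _ _) (le_max_right _ _)⟩
  have hbig := hpbig n hn1
  have hle := hple n hn1
  obtain ⟨h1, h2, h3⟩ := hn₀ n hn0 (pSel n) hbig hle
  -- Kronecker transport of a size-`(nᵃ + a)` circuit for the `n`-th member
  obtain ⟨s', a', g, hs', hdeg, hsupp, hrep⟩ :=
    hT k (pSel n) n (n ^ a + a) (by omega) hn1 hle (ha n)
  -- `p₀ ≤ pₙ`
  have hp0 : p₀ ≤ pSel n := by
    have h4n : n < k ^ n :=
      Nat.lt_two_pow_self.trans_le (Nat.pow_le_pow_left (by omega : 2 ≤ k) n)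
    omega
  -- feed the cheap representation to X
  have hsR : (s' : ℝ) ≤ (pSel n : ℝ) ^ δ := le_trans (by exact_mod_cast hs') h1
  have hdegP : ∀ i, (g i).natDegree ≤ pSel n ^ 2 := fun i => (hdeg i).trans h2
  have hrep' : (∑ i, Polynomial.C (a' i) * g i ^ 2) =
      ∑ m ∈ Finset.range (pSel n),
        Polynomial.C ((legendreSym (pSel n) m : ℤ) : ℂ) * Polynomial.X ^ m := by
    simpa only [feketePoly] using hrep
  have key := H (pSel n) hp0 s' a' g hsR hdegP hrep'
  -- … whose support-sum is too small
  have hsumN : (∑ i, (g i).support.card) ≤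
      ((n ^ a + a) * n + 2) ^ (cT * (Nat.log 2 n + 1)) *
        (k * n + (n + 1) / 2).choose ((n + 1) / 2) := by
    calc (∑ i, (g i).support.card)
        ≤ ∑ _i : Fin s', (k * n + (n + 1) / 2).choose ((n + 1) / 2) :=
          Finset.sum_le_sum fun i _ => hsupp i
      _ = s' * (k * n + (n + 1) / 2).choose ((n + 1) / 2) := by
          rw [Finset.sum_const, Finset.card_univ, Fintype.card_fin, smul_eq_mul]
      _ ≤ _ := Nat.mul_le_mul_right _ hs'
  have hsumR : (∑ i, ((g i).support.card : ℝ)) ≤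
      ((((n ^ a + a) * n + 2) ^ (cT * (Nat.log 2 n + 1)) *
          (k * n + (n + 1) / 2).choose ((n + 1) / 2) : ℕ) : ℝ) := by
    have hc := (Nat.cast_le (α := ℝ)).mpr hsumN
    rwa [Nat.cast_sum] at hc
  linarith

end Summit.ValiantsHypothesis.ValiantsHypothesis.Cruxes.SOSMagnification.GaussPhaseDefinability

end
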